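import Summits.ResolutionOfSingularities.ResolutionOfSingularities.Theorems.EquisingularLiftEquisingularLiftNatSpecimenSteinerStrictChartPackets
import Summits.ResolutionOfSingularities.ResolutionOfSingularities.Theorems.EquisingularLiftEquisingularLiftNatSpecimenSteinerFarPackets
import Summits.ResolutionOfSingularities.ResolutionOfSingularities.Theorems.EquisingularLiftEquisingularLiftNatSpecimenSteinerNoseCurve
import Summits.ResolutionOfSingularities.ResolutionOfSingularities.Theorems.EquisingularLiftEquisingularLiftNatBlowupRegularOfChartAtlas
import Summits.ResolutionOfSingularities.ResolutionOfSingularities.Theorems.EquisingularLiftEquisingularLiftStrictTransformBlowupModel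
import Literature.AlgebraicGeometry.Resolution.BlowupSequences
import HarnessLib

/-!
# [OURS · L1 W4.5(b) · EL♮(3) · NOSE, N-2 (d) assembly] STEINER — THE FINAL SURFACE OF THE NOSE TOWER IS REGULAR; «STEINER ∈ ν2» MODULO (c) ONLY

res-L1-w45b-nose-w2 g2 (WIDTH seat on D-0157 DOOR 1; self-dealt under the desk's N-2 GO, STATUS l.≈83270). OURS; NOT a statement of any manuscript
([Hironaka2017] is a candidate under adjudication, nothing of it is asserted); AI-written, weaker than expert review. No `sorry`; standard axioms; DEF-FREE
(standing `local instance` attribute of the specimen files). `--kind proof --supports stmt-ResolutionOfSingularities-20148 --as helper`; closes nothing.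
Resolution of singularities in positive characteristic is NOT proved here or anywhere in this chain (dimension 3 is Cossart–Piltant 2008/2009 in print);
EL♮(3) is NOT proved by this file.

WHAT. The tower of the nose schema for Steiner's Roman surface `S ⊂ ℙ³`: `υ : F₂ ⟶ ℙ³` ANY blowing up of the triple point `P`, `St = closure υ⁻¹(S ∖ P)`
its strict transform, `Z′ = ⋃ᵢ Lᵢ′` the three (disjoint, regular) strict transforms of the double lines, `υ' : F₃ ⟶ F₂` ANY blowing up of `𝓘⟨Z′⟩`, and
`St′ = closure υ'⁻¹(St ∖ Z′)`. This file proves clause (d) of «Steiner ∈ ν2»: **`St′~` is regular.**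
* §1 `isIntegral_redSub_strict` — `St~` is integral (✓ `isIrreducible_strictTransform_of_isBlowup`, ✓ `isIrreducible_range_ι`).
* §2 ★ `isRegular_of_isBlowup_strict` — EVERY blowing up of `St~` along `𝓘⟨Z′⟩·𝒪_{St~}` is regular: the chart-atlas frame ✓ `isRegular_of_isBlowup_of_chartAtlas`
  on the six packets ✓ `Steiner.packet_chart i` (vertex charts, ring `k[T]/(f₁)`) and ✓ `Steiner.packet_far c` (far charts, ring `k[T]/(g)`), which cover
  `St~` by ✓ `mem_preimage_basicOpen_or_mem_opensRange`; the twelve blow-up algebras are the regular rings of ✓ p649392.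
* §3 ★★ `isRegular_noseFinal` — clause (d) LITERALLY as the hypothesis `hfin` of ✓ `Steiner.noseHypPointsFirstBTriplePrime_of_unobs_of_final`
  (✓ `LinearCentre.isRegular_reducedStrictTransform_of_blowupModel`: the reduced strict transform is a blow-up of `St~` along `𝓘⟨Z′⟩·𝒪`, Hartshorne II 7.15;
  `St ⊄ Z′` is ✓ `not_strict_subset_iUnion_vertexLineStrict`).
* §4 ★★★ `noseHypPointsFirstBTriplePrime_of_unobs` — **«STEINER ∈ ν2» MODULO (c) ONLY**: the nose hypothesis
  `NoseHypPointsFirstBTriplePrime k 3 S ι` for the Roman surface follows from the single remaining input, the ×3 union certificate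
  `DirStepUnobs F₂ univ (⋃ᵢ Lᵢ′)` of some blowing up `υ` of `P` (nose-w3's brick (c)); `υ'` is taken to be the chosen blow-up ✓ `blowup.π`.
-/

set_option linter.dupNamespace false -- mandated namespace `Summit.<Summit>.<Problem>` of this single-conjunct summit

noncomputable section

open CategoryTheory CategoryTheory.Limits AlgebraicGeometry TopologicalSpace HomogeneousLocalization
open MvPolynomial
open Literature.AlgebraicGeometry.Resolution Literature.AlgebraicGeometry.Resolution.DeJong1996
open Literature.AlgebraicGeometry.Motives Literature.AlgebraicGeometry.Motives.SmoothHypersurface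
open Literature.AlgebraicGeometry.Motives.ProjectiveSpace
open AlgebraicGeometry.Scheme.IdealSheafData
open Summit.ResolutionOfSingularities.ResolutionOfSingularities.Theorems.EquisingularLift
open Summit.ResolutionOfSingularities.ResolutionOfSingularities.Cruxes.EquisingularLift.StrataSplit

attribute [local instance] MvPolynomial.gradedAlgebra ProjBaseChange.algebraBase

namespace Summit.ResolutionOfSingularities.ResolutionOfSingularities.Cruxes.EquisingularLiftNat.Sections

namespace Steiner

variable (k : Type) [Field k]

section Final

variable {k} {F₂ : Scheme.{0}} {υ : F₂ ⟶ SpecimenQuarticTcDelta.P3 k} (hυ : IsBlowup υ (vertexIdealSheaf 2 k))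

/-! ## §1 The reduced strict transform `St~` is integral -/

include hυ in
/-- **`St~` is integral**: the strict transform of the irreducible `S ⊄ {P}` under the blowing up of `{P}` is irreducible, and `St~` is reduced.
[cite: DeJong1996, 4.26] (folklore) -/
theorem isIntegral_redSub_strict :
    IsIntegral (redSub F₂ (closure (υ ⁻¹' (Set.range (hypersurfaceι (form k)).left \ {vertex 2 k}))) isClosed_closure) :=
  ComponentGluing.isIntegral_subscheme_vanishingIdeal _ (by
    change IsIrreducible (closure (υ ⁻¹' (Set.range (hypersurfaceι (form k)).left \ {vertex 2 k})))
    exact SpecimenQuarticTcDelta.isIrreducible_strictTransform_of_isBlowup ⟨{vertex 2 k}, isClosed_singleton_vertex 2 k⟩ hυ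
      (isIrreducible_range_ι k) (fun h => pointOfPrime_ne_vertex (k := k) (h (pointOfPrime_mem_range_ι (k := k)))))

/-! ## §2 Every blowing up of `St~` along `𝓘⟨Z′⟩·𝒪_{St~}` is regular (the six-packet atlas) -/

include hυ in
/-- ★ **Every blowing up of the reduced strict transform `St~` of the Roman surface along the ideal of the nose set `Z′ = ⋃ᵢ Lᵢ′` is a regular
scheme** — ✓ `isRegular_of_isBlowup_of_chartAtlas` on the atlas `Fin 3 ⊕ Fin 3`: three vertex packets ✓ `packet_chart` (rings `k[T]/(f₁)`) and three far
packets ✓ `packet_far` (rings `k[T]/(g)`), covering `St~` by ✓ `mem_preimage_basicOpen_or_mem_opensRange`; the generators are `T̄₁, T̄₂` and the twelve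
affine blow-up algebras are regular rings by ✓ `Steiner.isRegularRing_chart₁/₂` / `isRegularRing_chartFar₁/₂`. [OURS · L1 W4.5b · (d) blow-up model] -/
theorem isRegular_of_isBlowup_strict :
    ∀ (W : Scheme.{0}) (π : W ⟶ redSub F₂ (closure (υ ⁻¹' (Set.range (hypersurfaceι (form k)).left \ {vertex 2 k}))) isClosed_closure),
      IsBlowup π ((vanishingIdeal (⟨⋃ j : Fin 3, vertexLineStrict υ j, isClosed_iUnion_vertexLineStrict υ⟩ : Closeds F₂)).comap
        (redSubι F₂ (closure (υ ⁻¹' (Set.range (hypersurfaceι (form k)).left \ {vertex 2 k}))) isClosed_closure)) →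
      Scheme.IsRegular W := by
  classical
  -- the six packets
  have hθ := fun i : Fin 3 => exists_twisted_algEquiv (k := k) i
  choose θ hθi hθj using hθ
  have hv := fun i : Fin 3 => packet_chart hυ i (θ i) (hθi i) (hθj i)
  choose cv hcv hcomm hcovv hJv hregv using hv
  have hf := fun c : Fin 3 => packet_far hυ c
  choose cf hcf hcovf hJf hregf using hf
  -- the atlas indexed by `Fin 3 ⊕ Fin 3`
  let I : Fin 3 ⊕ Fin 3 → Ideal (MvPolynomial (Fin 3) k) := Sum.elim (fun _ => Ideal.span {f₁ k}) (fun _ => Ideal.span {g k})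
  let A : Fin 3 ⊕ Fin 3 → CommRingCat.{0} := fun a => CommRingCat.of (MvPolynomial (Fin 3) k ⧸ I a)
  let ch : ∀ a, Spec (A a) ⟶ redSub F₂ (closure (υ ⁻¹' (Set.range (hypersurfaceι (form k)).left \ {vertex 2 k}))) isClosed_closure :=
    fun a => Sum.rec (motive := fun a => Spec (A a) ⟶ redSub F₂ (closure (υ ⁻¹' (Set.range (hypersurfaceι (form k)).left \ {vertex 2 k})))
      isClosed_closure) (fun i => cv i) (fun c => cf c) a
  let gen : ∀ a, ↥({(0 : Fin 3)}ᶜ : Set (Fin 3)) → A a := fun a j => Ideal.Quotient.mk (I a) (X j.1 : MvPolynomial (Fin 3) k)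
  haveI : ∀ a, IsOpenImmersion (ch a) := fun a => by
    cases a with
    | inl i => exact hcv i
    | inr c => exact hcf c
  refine isRegular_of_isBlowup_of_chartAtlas _ A ch (fun z => ?_) gen (fun a => ?_) (fun a j => ?_)
  · rcases mem_preimage_basicOpen_or_mem_opensRange hυ
        (redSubι F₂ (closure (υ ⁻¹' (Set.range (hypersurfaceι (form k)).left \ {vertex 2 k}))) isClosed_closure z) with ⟨c, hc⟩ | ⟨i, hi⟩
    · exact ⟨Sum.inr c, hcovf c z hc⟩
    · exact ⟨Sum.inl i, hcovv i z hi⟩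
  · cases a with
    | inl i => exact hJv i
    | inr c => exact hJf c
  · cases a with
    | inl i => exact hregv i j
    | inr c => exact hregf c j

/-! ## §3 Clause (d): the final surface `St′~` is regular -/

include hυ in
/-- ★★ **CLAUSE (d) OF «STEINER ∈ ν2»**: for ANY blowing up `υ'` of `F₂` along `𝓘⟨Z′⟩`, the reduced closed subscheme of `F₃` on
`St′ = closure υ'⁻¹(St ∖ Z′)` is REGULAR — literally the hypothesis `hfin` of ✓ `Steiner.noseHypPointsFirstBTriplePrime_of_unobs_of_final`.
(`St′~` is a blowing up of `St~` along `𝓘⟨Z′⟩·𝒪_{St~}`, Hartshorne II 7.15 via ✓ `LinearCentre.isRegular_reducedStrictTransform_of_blowupModel`, and those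
are all regular by §2.) [OURS · L1 W4.5b · (d)] [cite: Hartshorne1977, II Cor. 7.15] -/
theorem isRegular_noseFinal {F₃ : Scheme.{0}} {υ' : F₃ ⟶ F₂}
    (hυ' : IsBlowup υ' (vanishingIdeal (⟨⋃ i : Fin 3, vertexLineStrict υ i, isClosed_iUnion_vertexLineStrict υ⟩ : Closeds F₂))) :
    Scheme.IsRegular (vanishingIdeal (⟨closure (υ' ⁻¹'
      (closure (υ ⁻¹' (Set.range (hypersurfaceι (form k)).left \ {vertex 2 k})) \ ⋃ i : Fin 3, vertexLineStrict υ i)),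
        isClosed_closure⟩ : Closeds F₃)).subscheme := by
  haveI : IsLocallyNoetherian F₂ := isLocallyNoetherian_of_isBlowup_vertex hυ
  haveI := isIntegral_redSub_strict hυ
  have hrange : Set.range (redSubι F₂ (closure (υ ⁻¹' (Set.range (hypersurfaceι (form k)).left \ {vertex 2 k}))) isClosed_closure) =
      closure (υ ⁻¹' (Set.range (hypersurfaceι (form k)).left \ {vertex 2 k})) := by
    refine (Scheme.IdealSheafData.range_subschemeι _).trans ?_
    rw [Scheme.IdealSheafData.coe_support_vanishingIdeal]
    rfl
  have hsupp : ((vanishingIdeal (⟨⋃ i : Fin 3, vertexLineStrict υ i, isClosed_iUnion_vertexLineStrict υ⟩ : Closeds F₂)).support : Set F₂) =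
      ⋃ i : Fin 3, vertexLineStrict υ i := by
    rw [Scheme.IdealSheafData.coe_support_vanishingIdeal]
    rfl
  have h := LinearCentre.isRegular_reducedStrictTransform_of_blowupModel
    (redSubι F₂ (closure (υ ⁻¹' (Set.range (hypersurfaceι (form k)).left \ {vertex 2 k}))) isClosed_closure)
    (vanishingIdeal (⟨⋃ i : Fin 3, vertexLineStrict υ i, isClosed_iUnion_vertexLineStrict υ⟩ : Closeds F₂))
    (by rw [hrange, hsupp]; exact not_strict_subset_iUnion_vertexLineStrict hυ) (isRegular_of_isBlowup_strict hυ) υ' hυ'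
  have hC : (⟨closure (υ' ⁻¹' (Set.range (redSubι F₂ (closure (υ ⁻¹' (Set.range (hypersurfaceι (form k)).left \ {vertex 2 k}))) isClosed_closure) \
      ((vanishingIdeal (⟨⋃ i : Fin 3, vertexLineStrict υ i, isClosed_iUnion_vertexLineStrict υ⟩ : Closeds F₂)).support : Set F₂))), isClosed_closure⟩ :
        Closeds F₃) =
      ⟨closure (υ' ⁻¹' (closure (υ ⁻¹' (Set.range (hypersurfaceι (form k)).left \ {vertex 2 k})) \ ⋃ i : Fin 3, vertexLineStrict υ i)),
        isClosed_closure⟩ :=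
    Closeds.ext (by simp only [Closeds.coe_mk]; rw [hrange, hsupp])
  rw [hC] at h
  exact h

/-! ## §4 «Steiner ∈ ν2» modulo the union certificate (c) -/

include hυ in
/-- ★★★ **«STEINER ∈ ν2» MODULO (c) ONLY.** For Steiner's Roman surface `S = V₊(x₀²x₁² + x₁²x₂² + x₂²x₀² + x₀x₁x₂x₃) ⊂ ℙ³_k` (`k` algebraically closed) and
ANY blowing up `υ : F₂ ⟶ ℙ³` of its triple point: if the three strict-transform double lines admit the union certificate `DirStepUnobs F₂ univ (⋃ᵢ Lᵢ′)`
(brick (c), nose-w3), then `S` satisfies the nose hypothesis `NoseHypPointsFirstBTriplePrime k 3 S ι` — ✓ `noseHypPointsFirstBTriplePrime_of_unobs_of_final`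
fed with the chosen blowing up `υ' = blowup.π 𝓘⟨Z′⟩` and clause (d) §3. FIRST KERNEL INHABITANT of the nose hypothesis modulo one certificate.
[OURS · L1 W4.5b · «Steiner ∈ ν2» modulo (c)] -/
theorem noseHypPointsFirstBTriplePrime_of_unobs [IsAlgClosed k]
    (hunobs : DirStepUnobs F₂ Set.univ isClosed_univ (⋃ i : Fin 3, vertexLineStrict υ i) (isClosed_iUnion_vertexLineStrict υ)) :
    NoseHypPointsFirstBTriplePrime k 3 (hypersurface (form k)).left (hypersurfaceι (form k)).left :=
  noseHypPointsFirstBTriplePrime_of_unobs_of_final k hυ hunobs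
    (blowup.isBlowup (vanishingIdeal (⟨⋃ i : Fin 3, vertexLineStrict υ i, isClosed_iUnion_vertexLineStrict υ⟩ : Closeds F₂)))
    (isRegular_noseFinal hυ (blowup.isBlowup _))

end Final

/-- ★★★ **«STEINER ∈ ν2» FROM THE UNION CERTIFICATE AS A LEMMA ABOUT ALL BLOWINGS UP** — the closing one-liner's shape: if brick (c) is proved for every
blowing up of the triple point (as nose-w3's files are stated), the nose hypothesis holds OUTRIGHT, the tower being the chosen blow-ups ✓ `blowup.π`.
[OURS · L1 W4.5b · «Steiner ∈ ν2» modulo (c)] -/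
theorem noseHypPointsFirstBTriplePrime_of_forall_unobs [IsAlgClosed k]
    (hunobs : ∀ {F₂ : Scheme.{0}} (υ : F₂ ⟶ SpecimenQuarticTcDelta.P3 k), IsBlowup υ (vertexIdealSheaf 2 k) →
      DirStepUnobs F₂ Set.univ isClosed_univ (⋃ i : Fin 3, vertexLineStrict υ i) (isClosed_iUnion_vertexLineStrict υ)) :
    NoseHypPointsFirstBTriplePrime k 3 (hypersurface (form k)).left (hypersurfaceι (form k)).left :=
  noseHypPointsFirstBTriplePrime_of_unobs (blowup.isBlowup (vertexIdealSheaf 2 k)) (hunobs _ (blowup.isBlowup (vertexIdealSheaf 2 k)))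

end Steiner

end Summit.ResolutionOfSingularities.ResolutionOfSingularities.Cruxes.EquisingularLiftNat.Sections

end
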